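import Summits.QuantumFields.YangMills.Theorems.VirialFluxGapResolventFieldPointwise
import Summits.QuantumFields.YangMills.Theorems.VirialFluxGapCentralZeroModeField
import Summits.QuantumFields.YangMills.Theorems.LuscherReductionRunningReductionAxialGauge
import HarnessLib

/-!
# Route `VirialFluxGap` (YangMills): the FRAME FAMILY of the tree-gauged space `X_fix` (one orthonormal 𝔰𝔲(2) basis per variable)

Item (B) of fcl-p3's roadmap ∕ LEAD's ruling (2026-08-30T23:21Z ∕ 23:30Z) for the ⟨stmt-QuantumFields-24141⟩ `PeriodicSoftness` team: the
concrete frame family `τ` in which the host's frame Hessian of the zero-flux deficit on `X_fix` is taken (✓`FrameHessian.dirOf`,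
`frameGrad`, `frameHessRaw`, `frameHess` of ✓`VirialFluxGapResolventFieldPointwise` are agnostic of `τ`).

* §1 the 𝔰𝔲(2) basis `E_a = quatMatrix (zUnit a)` of w3's unit imaginary quaternions ✓`zUnit` (skew-Hermitian, traceless:
  ✓`quatMatrix_zUnit_conjTranspose` ∕ `_trace`); ★ `sum_smul_quatMatrix_zUnit` — `Σ_a c_a·E_a = quatMatrix ⟨0, c 0, c 1, c 2⟩`.
* §2 `FixVar L = OffIdx L ⊕ (Fin (2L−1) × Edge 3 L) ⊕ Site 3 L` — the variables of `X_fix` (off-tree links of slice `0`, all links of the later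
  slices, the seam sites) and the injection `fixVar` into the variables `(Fin (2L−1+1) × Edge 3 L) ⊕ Site 3 L` of the ring space
  (`fixVar_injective`; every ring variable is either in the image or a TREE link of slice `0`: `exists_fixVar_or_tree`); wrap links are
  off-tree (`not_treeEdge_of_wrap`).
* §3 ★ `fixFrame : FixVar L × Fin 3 → assignments` — `fixFrame (v,a)` is `E_a = quatMatrix (zUnit a)` at the ring variable `fixVar v` and `0` elsewhere;
  `fixFrame_conjTranspose` ∕ `fixFrame_trace` (the hypotheses `hτ`, `hτ0` of ✓`pointwise_taylor_package`); ★ `dirOf_fixFrame_fixVar`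
  (`Y_u (fixVar v) = Σ_a u(v,a)·E_a`) and `dirOf_fixFrame_tree` (`Y_u = 0` on the tree links of slice `0`) — so `frameHess fixFrame` is exactly
  the principal `J_fix × J_fix` block of the ring-space frame Hessian announced by fcl-p3 (2026-08-30T23:21Z), `#ι = 3·#FixVar L`.

HONEST FRAMING: definitions and bookkeeping only (three problem-side data definitions `FixVar`, `fixVar`, `fixFrame`; no `Prop`);
⟨24141⟩ and ⟨22884⟩ stay OPEN; no stub ∕ crux ∕ rung ∕ summit is closed; the Yang–Mills mass gap is NOT proved; no summit is proved by a line.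
0 `sorry`, standard axioms.  Width seat `ym-line-sfw-p2-w2` g51 (cell ym-idea-1, free hands), `--supports stmt-QuantumFields-24141`.
References: [folklore].
-/

set_option autoImplicit false

noncomputable section

open scoped Matrix BigOperators Quaternion
open Matrix
open Literature.MathematicalPhysics.QuantumFieldTheory hiding SU2
open Literature.MathematicalPhysics.QuantumLattice

namespace Summit.QuantumFields.YangMills.Theorems.VirialFluxGap.FixFrame

open Summit.QuantumFields.YangMills.Theorems.FemtoTransferGap
open Summit.QuantumFields.YangMills.Theorems.FemtoTransferGap.TT
open Summit.QuantumFields.YangMills.Theorems.VirialFluxGap.FrameDerivative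
open Summit.QuantumFields.YangMills.Theorems.VirialFluxGap.FrameHessian

variable {L : ℕ} [NeZero L]

/-! ## §1 The 𝔰𝔲(2) basis (w3's unit imaginary quaternions ✓`zUnit`) -/

omit [NeZero L] in
/-- ★ Linear combinations of the basis `E_a = quatMatrix (zUnit a)`: `Σ_a c_a·E_a = quatMatrix ⟨0, c 0, c 1, c 2⟩`. [folklore] -/
theorem sum_smul_quatMatrix_zUnit (c : Fin 3 → ℝ) : ∑ a, c a • quatMatrix (zUnit a) = quatMatrix (⟨0, c 0, c 1, c 2⟩ : ℍ) := by
  ext i j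
  simp only [Matrix.sum_apply, Matrix.smul_apply, Fin.sum_univ_three, zUnit, quatMatrix, Fin.isValue, Matrix.cons_val_zero,
    Matrix.cons_val_one, Matrix.cons_val]
  fin_cases i <;> fin_cases j <;> simp [Complex.ext_iff]

/-! ## §2 The variables of `X_fix` inside the variables of the ring space -/

/-- The variables of the tree-gauged space `X_fix`: off-tree links of slice `0`, all links of the `2L−1` later slices, the seam sites.
[folklore] -/
abbrev FixVar (L : ℕ) : Type := OffIdx L ⊕ ((Fin (2 * L - 1) × Edge 3 L) ⊕ Site 3 L)

/-- The injection of the `X_fix` variables into the ring-space variables. [folklore] -/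
def fixVar : FixVar L → (Fin (2 * L - 1 + 1) × Edge 3 L) ⊕ Site 3 L :=
  Sum.elim (fun e => Sum.inl (0, e.1)) (Sum.elim (fun je => Sum.inl (je.1.succ, je.2)) fun x => Sum.inr x)

omit [NeZero L] in
/-- `fixVar` on an off-tree link of slice `0`. [folklore] -/
@[simp] theorem fixVar_off (e : OffIdx L) : fixVar (Sum.inl e) = Sum.inl (0, e.1) := rfl

omit [NeZero L] in
/-- `fixVar` on a link of a later slice. [folklore] -/
@[simp] theorem fixVar_slice (je : Fin (2 * L - 1) × Edge 3 L) : fixVar (L := L) (Sum.inr (Sum.inl je)) = Sum.inl (je.1.succ, je.2) := rfl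

omit [NeZero L] in
/-- `fixVar` on a seam site. [folklore] -/
@[simp] theorem fixVar_seam (x : Site 3 L) : fixVar (L := L) (Sum.inr (Sum.inr x)) = Sum.inr x := rfl

omit [NeZero L] in
/-- `fixVar` is injective. [folklore] -/
theorem fixVar_injective : Function.Injective (fixVar (L := L)) := by
  rintro (e | je | x) (e' | je' | x') h
  · simp only [fixVar_off, Sum.inl.injEq, Prod.mk.injEq, true_and] at h
    rw [Subtype.ext h]
  · simp only [fixVar_off, fixVar_slice, Sum.inl.injEq, Prod.mk.injEq] at h
    exact absurd h.1.symm (Fin.succ_ne_zero _)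
  · simp only [fixVar_off, fixVar_seam, reduceCtorEq] at h
  · simp only [fixVar_slice, fixVar_off, Sum.inl.injEq, Prod.mk.injEq] at h
    exact absurd h.1 (Fin.succ_ne_zero _)
  · simp only [fixVar_slice, Sum.inl.injEq, Prod.mk.injEq, Fin.succ_inj] at h
    rw [show je = je' from Prod.ext h.1 h.2]
  · simp only [fixVar_slice, fixVar_seam, reduceCtorEq] at h
  · simp only [fixVar_seam, fixVar_off, reduceCtorEq] at h
  · simp only [fixVar_seam, fixVar_slice, reduceCtorEq] at h
  · simp only [fixVar_seam, Sum.inr.injEq] at h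
    rw [h]

omit [NeZero L] in
/-- Wrap links (`x_k = −1` in their own direction) are off the comb tree. [folklore] -/
theorem not_treeEdge_of_wrap {e : Edge 3 L} (h : e.1 e.2 = -1) : ¬ treeEdge e = true := by
  rw [treeEdge_iff]
  rintro (⟨h2, hne⟩ | ⟨h2, -, hne⟩ | ⟨h2, -, -, hne⟩) <;> exact hne (by rw [← h2]; exact h)

omit [NeZero L] in
/-- Every ring-space variable is an `X_fix` variable or a tree link of slice `0`. [folklore] -/
theorem exists_fixVar_or_tree (w : (Fin (2 * L - 1 + 1) × Edge 3 L) ⊕ Site 3 L) :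
    (∃ v : FixVar L, fixVar v = w) ∨ ∃ e : Edge 3 L, treeEdge e = true ∧ w = Sum.inl (0, e) := by
  rcases w with ⟨i, e⟩ | x
  · induction i using Fin.cases with
    | zero =>
      by_cases he : treeEdge e = true
      · exact Or.inr ⟨e, he, rfl⟩
      · exact Or.inl ⟨Sum.inl ⟨e, he⟩, rfl⟩
    | succ j => exact Or.inl ⟨Sum.inr (Sum.inl (j, e)), rfl⟩
  · exact Or.inl ⟨Sum.inr (Sum.inr x), rfl⟩

omit [NeZero L] in
/-- A tree link of slice `0` is not an `X_fix` variable. [folklore] -/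
theorem fixVar_ne_tree {e : Edge 3 L} (he : treeEdge e = true) (v : FixVar L) : fixVar v ≠ Sum.inl (0, e) := by
  rcases v with e' | je | x
  · rw [fixVar_off]
    intro h
    simp only [Sum.inl.injEq, Prod.mk.injEq, true_and] at h
    exact e'.2 (h ▸ he)
  · rw [fixVar_slice]
    intro h
    simp only [Sum.inl.injEq, Prod.mk.injEq] at h
    exact Fin.succ_ne_zero _ h.1
  · rw [fixVar_seam]
    exact Sum.inr_ne_inl

/-! ## §3 The frame family -/

/-- ★ The FRAME FAMILY of `X_fix`: `fixFrame (v,a)` is the basis matrix `E_a = quatMatrix (zUnit a)` at the ring variable `fixVar v` and `0` at every other variable.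
[folklore] -/
def fixFrame (va : FixVar L × Fin 3) (w : (Fin (2 * L - 1 + 1) × Edge 3 L) ⊕ Site 3 L) : Matrix (Fin 2) (Fin 2) ℂ :=
  if w = fixVar va.1 then quatMatrix (zUnit va.2) else 0

omit [NeZero L] in
/-- The frame family is skew-Hermitian (hypothesis `hτ` of ✓`pointwise_taylor_package`). [folklore] -/
theorem fixFrame_conjTranspose (va : FixVar L × Fin 3) (w : (Fin (2 * L - 1 + 1) × Edge 3 L) ⊕ Site 3 L) :
    (fixFrame va w)ᴴ = -fixFrame va w := by
  unfold fixFrame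
  split_ifs
  · exact quatMatrix_zUnit_conjTranspose _
  · rw [conjTranspose_zero, neg_zero]

omit [NeZero L] in
/-- The frame family is traceless (hypothesis `hτ0` of ✓`pointwise_taylor_package`). [folklore] -/
theorem fixFrame_trace (va : FixVar L × Fin 3) (w : (Fin (2 * L - 1 + 1) × Edge 3 L) ⊕ Site 3 L) : (fixFrame va w).trace = 0 := by
  unfold fixFrame
  split_ifs
  · exact quatMatrix_zUnit_trace _
  · exact Matrix.trace_zero _ _

/-- ★ The direction with coordinates `u` at an `X_fix` variable: `Y_u (fixVar v) = Σ_a u(v,a)·E_a`. [folklore] -/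
theorem dirOf_fixFrame_fixVar (u : FixVar L × Fin 3 → ℝ) (v : FixVar L) :
    dirOf (fixFrame (L := L)) u (fixVar v) = ∑ a, u (v, a) • quatMatrix (zUnit a) := by
  rw [dirOf, Finset.sum_apply, Fintype.sum_prod_type, Finset.sum_eq_single v]
  · refine Finset.sum_congr rfl fun a _ => ?_
    rw [Pi.smul_apply, fixFrame, if_pos rfl]
  · intro v' _ hv'
    refine Finset.sum_eq_zero fun a _ => ?_
    rw [Pi.smul_apply, fixFrame, if_neg (fun h => hv' (fixVar_injective h).symm), smul_zero]
  · intro h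
    exact absurd (Finset.mem_univ v) h

/-- ★ In coordinates `(c 0, c 1, c 2)` at the variable `v`: `Y_u (fixVar v) = quatMatrix ⟨0, u(v,0), u(v,1), u(v,2)⟩`. [folklore] -/
theorem dirOf_fixFrame_fixVar_eq_quatMatrix (u : FixVar L × Fin 3 → ℝ) (v : FixVar L) :
    dirOf (fixFrame (L := L)) u (fixVar v) = quatMatrix (⟨0, u (v, 0), u (v, 1), u (v, 2)⟩ : ℍ) := by
  rw [dirOf_fixFrame_fixVar]
  exact sum_smul_quatMatrix_zUnit fun a => u (v, a)

/-- The direction with coordinates `u` vanishes off the image of `fixVar`. [folklore] -/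
theorem dirOf_fixFrame_of_ne (u : FixVar L × Fin 3 → ℝ) {w : (Fin (2 * L - 1 + 1) × Edge 3 L) ⊕ Site 3 L} (hw : ∀ v, fixVar v ≠ w) :
    dirOf (fixFrame (L := L)) u w = 0 := by
  rw [dirOf, Finset.sum_apply]
  refine Finset.sum_eq_zero fun va _ => ?_
  rw [Pi.smul_apply, fixFrame, if_neg (fun h => hw va.1 h.symm), smul_zero]

/-- ★ The direction with coordinates `u` vanishes on the tree links of slice `0` (they are not variables of `X_fix`). [folklore] -/
theorem dirOf_fixFrame_tree (u : FixVar L × Fin 3 → ℝ) {e : Edge 3 L} (he : treeEdge e = true) :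
    dirOf (fixFrame (L := L)) u (Sum.inl (0, e)) = 0 :=
  dirOf_fixFrame_of_ne u (fixVar_ne_tree he)

/-- The number of frame coordinates is three times the number of `X_fix` variables. [folklore] -/
theorem card_fixFrame_index : Fintype.card (FixVar L × Fin 3) = 3 * Fintype.card (FixVar L) := by
  rw [Fintype.card_prod, Fintype.card_fin, mul_comm]

end Summit.QuantumFields.YangMills.Theorems.VirialFluxGap.FixFrame

end
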